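import Literature.Computability.Complexity.ProbabilisticClassesProofs
import Literature.Computability.Complexity.CoinCounting
import Literature.Computability.Complexity.CoinTruncation
import Literature.Computability.Complexity.StringCopy
import Literature.Computability.Complexity.CircuitClassesProofs
import HarnessLib

/-!
# Error reduction for `BPP` (proofs; trunk CplxCore)

Sibling proof file of `ProbabilisticClasses.lean` (D-0014), continuing
`ProbabilisticClassesProofs.lean`: discharge of the named fact
`exists_randAlg_error_le_of_mem_BPP` — for `L ∈ BPP` and every constant `ε > 0` some
probabilistic polynomial-time algorithm with an exactly polynomial coin budget decides `L` with
error at most `ε` on **every** input (Arora–Barak 2009, §7.4.1 and Thm. 7.10, constant-error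
case: "we can replace `2/3` with any constant larger than `1/2`"; Sipser 2012, Lemma 10.5,
the amplification lemma).

No Turing machine is programmed. The printed proof (Arora–Barak, Thm. 7.10) runs the machine
`k = 8|x|^{2c+d}` times on independent coins, outputs the majority answer, and bounds the error by
the Chernoff inequality (for a constant target error a constant `k` suffices). Here, as in
`CircuitClassesProofs.lean` (Adleman's theorem), the majority vote is taken over **three**
independent runs and iterated a constant number of times, which keeps both halves elementary and
inside the tree's toolkit:

* *machines* — one round replaces the witness language `L' ∈ P` (coins `p(n)`) by
  `maj3Lang L' p ∈ P` (coins `3 p(n)`), the "at least two out of three" combination of the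
  preimages of `L'` under the coin-block maps `⟨x, y⟩ ↦ ⟨x, y↾P⟩`, `⟨x, (y⇂P)↾P⟩`, `⟨x, y⇂P⇂P⟩`
  (`truncSndFn`, `dropSndFn ∈ FP`, `CoinTruncation.lean`); `P` is closed under polynomial-time
  preimages, `⊓` and `⊔` (`ReductionsProofs.preimage_mem_P`, `StringCopy.inter_mem_P`,
  `union_mem_P`);
* *probability* — if a fraction `≤ e` of the coin blocks is bad for `x`, the fraction of bad
  triples is exactly `u²(3 - 2u) ≤ e²(3 - 2e)` (`u` the bad fraction; product rule
  `cnt_take_drop` of `ProbabilisticClassesProofs.lean`, monotonicity `sq_mul_three_sub_mono` of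
  `CircuitClassesProofs.lean`), and the recursion `e ↦ e²(3 - 2e)` from `e₀ = 1/3` is
  eventually below every `ε > 0` (`err_bound_of_rec`, ibid.: `3 e₃₊ⱼ ≤ 2^{-2^j}`).

Finally the operator form is turned into Gill's machine form (`RandAlg`): run
`x, r ↦ [⟨x, r⟩ ∈ L'ₖ]` with exactly `pₖ(|x|)` coins; its running time is that of the decider of
`L'ₖ` read through the pairing (`RandAlg.IsPolyTime`), and `RandAlg.pr` is the counting
probability `uniformProb` (`RandAlg.pr_eq_uniformProb`).

Main results: `bpErr` (the `BP·` operator with two-sided error `e`), `mem_bpErr_maj3`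
(one round), `BPP_subset_bpErr_errSeq` (all rounds), `exists_randAlg_error_le_of_mem_BPP_holds`.

## References

* S. Arora, B. Barak, *Computational Complexity: A Modern Approach*, CUP 2009, §7.4.1 and
  Thm. 7.10 (error reduction for `BPP`: "run `M(x)` for `k` times obtaining `k` outputs … if the
  majority of these outputs is `1`, then output `1`; otherwise, output `0`"), Def. 7.2–7.3,
  Claim 1.6 / Thm. 2.8 (closure under composition).
  doi:10.1017/cbo9780511804090
* M. Sipser, *Introduction to the Theory of Computation*, 3rd ed., Cengage 2012, Lemma 10.5
  (amplification lemma for `BPP`).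
* J. Gill, *Computational complexity of probabilistic Turing machines*, SIAM J. Comput. 6 (1977),
  Def. 5.2 (machine form of `BPP`).
-/

namespace Literature.Computability.Complexity

open _root_.Computability Polynomial

/-! ### The `BP·` operator with error `e` -/

/-- `bpErr C e`: the languages `L` admitting a witness `L' ∈ C` and a coin polynomial `p` such
that for every input `x` the fraction of coin strings `y ∈ {0,1}^{p(|x|)}` giving the *wrong*
verdict `¬ ([⟨x,y⟩ ∈ L'] ↔ [x ∈ L])` is at most `e` (so `bp C ⊆ bpErr C (1/3)`).
[Arora–Barak 2009, Def. 7.2–7.3 and §7.4.1 (`BPP` with error probability `e`)]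
[cite: AroraBarakCC2009, §7.4.1] -/
def bpErr (C : Set (Language Bool)) (e : ℝ) : Set (Language Bool) :=
  {L | ∃ L' ∈ C, ∃ p : Polynomial ℕ, ∀ x : List Bool,
    uniformProb (p.eval x.length) {y : List Bool | ¬ (boolPair x y ∈ L' ↔ x ∈ L)} ≤ e}

/-- `bp C ⊆ bpErr C (1/3)`: success probability `≥ 2/3` is error probability `≤ 1/3`
(`uniformProb_compl`). [Arora–Barak 2009, Def. 7.2–7.3] [cite: AroraBarakCC2009, §7.4.1] -/
theorem bp_subset_bpErr_third (C : Set (Language Bool)) : bp C ⊆ bpErr C (1 / 3) := by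
  rintro L ⟨L', hL', p, hp⟩
  refine ⟨L', hL', p, fun x => ?_⟩
  have h := hp x
  rw [← Set.compl_setOf, uniformProb_compl]
  linarith

/-! ### At least two out of three -/

/-- "At least two of the three propositions hold" — the majority of three verdicts, the
`Prop`-valued counterpart of `maj3` (`CircuitClassesProofs.lean`).
[Arora–Barak 2009, Thm. 7.10 (proof: "the majority of these outputs")] [folklore] -/
def TwoOfThree (p q r : Prop) : Prop := p ∧ q ∨ p ∧ r ∨ q ∧ r

/-- The majority verdict is wrong iff at least two of the three verdicts are wrong.
[Arora–Barak 2009, Thm. 7.10 (proof)] [folklore] -/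
theorem not_twoOfThree_iff (p q r s : Prop) :
    ¬ (TwoOfThree p q r ↔ s) ↔ TwoOfThree (¬ (p ↔ s)) (¬ (q ↔ s)) (¬ (r ↔ s)) := by
  unfold TwoOfThree
  by_cases hp : p <;> by_cases hq : q <;> by_cases hr : r <;> by_cases hs : s <;>
    simp [hp, hq, hr, hs]

/-- The bad triples: coin strings `y = y₁ y₂ y₃ ∈ {0,1}^{3m}` at least two of whose blocks
`y₁ = y↾m`, `y₂ = (y⇂m)↾m`, `y₃ = y⇂m⇂m` lie in the bad event `B`. [Arora–Barak 2009, Thm. 7.10]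
[folklore] -/
def badTriples (m : ℕ) (B : Set (List Bool)) : Set (List Bool) :=
  {y | TwoOfThree (y.take m ∈ B) ((y.drop m).take m ∈ B) ((y.drop m).drop m ∈ B)}

/-- `cnt` is additive on disjoint events. [folklore] -/
theorem cnt_union_of_disjoint (n : ℕ) {S T : Set (List Bool)} (h : Disjoint S T) :
    cnt n (S ∪ T) = cnt n S + cnt n T := by
  classical
  unfold cnt
  rw [← Finset.card_union_of_disjoint]
  · congr 1
    ext r
    simp [Finset.mem_filter, Finset.mem_union]
  · rw [Finset.disjoint_filter]
    intro r _ hS hT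
    exact Set.disjoint_left.1 h hS hT

/-- **One round of majority-of-three, counted.** If the bad event `B ⊆ {0,1}^m` has probability
at most `e ≤ 1`, the bad triples have probability at most `e² (3 - 2e)`: with `b = #B` and
`a = 2^m - b`, the bad triples number exactly `b · #{y₂ y₃ | y₂ ∈ B ∨ y₃ ∈ B} + a · b² =
b (4^m - a²) + a b² = b² (3 · 2^m - 2b)` (product rule `cnt_take_drop`), and `u ↦ u²(3 - 2u)` is
monotone on `[0, 1]` (`sq_mul_three_sub_mono`). [Arora–Barak 2009, Thm. 7.10 (three runs,
exact count instead of the Chernoff bound)] [cite: AroraBarakCC2009, Thm. 7.10] -/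
theorem uniformProb_badTriples_le {m : ℕ} {B : Set (List Bool)} {e : ℝ}
    (hB : uniformProb m B ≤ e) (he : e ≤ 1) :
    uniformProb (m + (m + m)) (badTriples m B) ≤ e ^ 2 * (3 - 2 * e) := by
  classical
  -- the two-block events
  set F₁ : Set (List Bool) := {z | z.take m ∈ B ∨ z.drop m ∈ B} with hF₁def
  set F₂ : Set (List Bool) := {z | z.take m ∈ B ∧ z.drop m ∈ B} with hF₂def
  have hab : cnt m B + cnt m Bᶜ = 2 ^ m := cnt_add_cnt_compl m B
  have hF₂ : cnt (m + m) F₂ = cnt m B * cnt m B := cnt_take_drop m m B B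
  have hF₁ : cnt (m + m) F₁ + cnt m Bᶜ * cnt m Bᶜ = 2 ^ (m + m) := by
    have h1 := cnt_add_cnt_compl (m + m) F₁
    have h2 : cnt (m + m) F₁ᶜ = cnt m Bᶜ * cnt m Bᶜ := by
      rw [← cnt_take_drop m m Bᶜ Bᶜ]
      exact cnt_congr fun z _ => by simp [hF₁def, not_or]
    rw [← h2]
    exact h1
  -- split the bad triples by the first block
  have hsplit : badTriples m B =
      {y | y.take m ∈ B ∧ y.drop m ∈ F₁} ∪ {y | y.take m ∈ Bᶜ ∧ y.drop m ∈ F₂} := by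
    ext y
    simp only [badTriples, TwoOfThree, Set.mem_setOf_eq, Set.mem_union, hF₁def, hF₂def,
      Set.mem_compl_iff]
    tauto
  have hdisj : Disjoint {y : List Bool | y.take m ∈ B ∧ y.drop m ∈ F₁}
      {y : List Bool | y.take m ∈ Bᶜ ∧ y.drop m ∈ F₂} :=
    Set.disjoint_left.2 fun y h₁ h₂ => h₂.1 h₁.1
  have hN : cnt (m + (m + m)) (badTriples m B) =
      cnt m B * cnt (m + m) F₁ + cnt m Bᶜ * (cnt m B * cnt m B) := by
    rw [hsplit, cnt_union_of_disjoint _ hdisj, cnt_take_drop, cnt_take_drop, hF₂]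
  -- pass to the reals
  rw [uniformProb_eq_cnt_div] at hB
  rw [uniformProb_eq_cnt_div, hN]
  set t : ℝ := (2 : ℝ) ^ m with ht
  have htpos : 0 < t := by positivity
  have hu0 : 0 ≤ (cnt m B : ℝ) / t := by positivity
  have key := sq_mul_three_sub_mono hu0 hB he
  refine le_trans (le_of_eq ?_) key
  have hab' : (cnt m Bᶜ : ℝ) = t - cnt m B := by
    have := congrArg (Nat.cast (R := ℝ)) hab
    push_cast at this
    linarith
  have hF₁' : (cnt (m + m) F₁ : ℝ) = t * t - (cnt m Bᶜ : ℝ) * cnt m Bᶜ := by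
    have := congrArg (Nat.cast (R := ℝ)) hF₁
    push_cast [pow_add] at this
    linarith
  have ht3 : (2 : ℝ) ^ (m + (m + m)) = t * (t * t) := by rw [pow_add, pow_add]
  rw [ht3]
  push_cast
  rw [hF₁', hab']
  field_simp
  ring

/-! ### One round at the level of languages -/

/-- **The majority-of-three witness language.** For a witness `L'` with coin polynomial `p`
(`P = p(|x|)`): `⟨x, y⟩ ∈ maj3Lang L' p` iff at least two of `⟨x, y↾P⟩`, `⟨x, (y⇂P)↾P⟩`,
`⟨x, y⇂P⇂P⟩` lie in `L'` — the three runs on the coin blocks of `y ∈ {0,1}^{3P}`, combined from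
the preimages of `L'` under the block maps (`truncSndFn`, `dropSndFn`) by `⊓`, `⊔`.
[Arora–Barak 2009, Thm. 7.10 (proof: run `M(x)` `k` times and output the majority answer; here
`k = 3`)] [cite: AroraBarakCC2009, Thm. 7.10] -/
noncomputable def maj3Lang (L' : Language Bool) (p : Polynomial ℕ) : Language Bool :=
  (truncSndFn p ⁻¹' L' ⊓ (truncSndFn p ∘ dropSndFn p) ⁻¹' L') ⊔
    ((truncSndFn p ⁻¹' L' ⊓ (dropSndFn p ∘ dropSndFn p) ⁻¹' L') ⊔
      ((truncSndFn p ∘ dropSndFn p) ⁻¹' L' ⊓ (dropSndFn p ∘ dropSndFn p) ⁻¹' L'))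

/-- Membership in `maj3Lang`: the three runs on the coin blocks. [Arora–Barak 2009, Thm. 7.10]
[cite: AroraBarakCC2009, Thm. 7.10] -/
theorem boolPair_mem_maj3Lang (L' : Language Bool) (p : Polynomial ℕ) (x y : List Bool) :
    boolPair x y ∈ maj3Lang L' p ↔
      TwoOfThree (boolPair x (y.take (p.eval x.length)) ∈ L')
        (boolPair x ((y.drop (p.eval x.length)).take (p.eval x.length)) ∈ L')
        (boolPair x ((y.drop (p.eval x.length)).drop (p.eval x.length)) ∈ L') := by
  change (truncSndFn p (boolPair x y) ∈ L' ∧ truncSndFn p (dropSndFn p (boolPair x y)) ∈ L') ∨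
      ((truncSndFn p (boolPair x y) ∈ L' ∧ dropSndFn p (dropSndFn p (boolPair x y)) ∈ L') ∨
        (truncSndFn p (dropSndFn p (boolPair x y)) ∈ L' ∧
          dropSndFn p (dropSndFn p (boolPair x y)) ∈ L')) ↔ _
  simp only [truncSndFn_boolPair, dropSndFn_boolPair, TwoOfThree]

/-- **`maj3Lang L' p ∈ P` for `L' ∈ P`**: `P` is closed under polynomial-time preimages
(`preimage_mem_P`; the block maps are in `FP`, `truncSndFn_mem_FP`, `dropSndFn_mem_FP`,
`comp_mem_FP`), intersection and union (`inter_mem_P`, `union_mem_P`).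
[Arora–Barak 2009, Thm. 7.10 with Claim 1.6 / Thm. 2.8 (polynomial overhead of repetition)]
[cite: AroraBarakCC2009, Thm. 7.10] -/
theorem maj3Lang_mem_P {L' : Language Bool} (hL' : L' ∈ Classes.P) (p : Polynomial ℕ) :
    maj3Lang L' p ∈ Classes.P := by
  have h₁ : truncSndFn p ⁻¹' L' ∈ Classes.P := preimage_mem_P hL' (truncSndFn_mem_FP p)
  have h₂ : (truncSndFn p ∘ dropSndFn p) ⁻¹' L' ∈ Classes.P :=
    preimage_mem_P hL' (comp_mem_FP (truncSndFn_mem_FP p) (dropSndFn_mem_FP p))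
  have h₃ : (dropSndFn p ∘ dropSndFn p) ⁻¹' L' ∈ Classes.P :=
    preimage_mem_P hL' (comp_mem_FP (dropSndFn_mem_FP p) (dropSndFn_mem_FP p))
  exact union_mem_P (inter_mem_P h₁ h₂) (union_mem_P (inter_mem_P h₁ h₃) (inter_mem_P h₂ h₃))

/-- The wrong-verdict event of `maj3Lang L' p` at `x` is the event of bad triples for the
wrong-verdict event of `L'` at `x` (`not_twoOfThree_iff`). [Arora–Barak 2009, Thm. 7.10 (proof)]
[folklore] -/
theorem setOf_not_maj3Lang_iff (L L' : Language Bool) (p : Polynomial ℕ) (x : List Bool) :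
    {y : List Bool | ¬ (boolPair x y ∈ maj3Lang L' p ↔ x ∈ L)} =
      badTriples (p.eval x.length) {c : List Bool | ¬ (boolPair x c ∈ L' ↔ x ∈ L)} := by
  ext y
  simp only [Set.mem_setOf_eq, badTriples, boolPair_mem_maj3Lang, not_twoOfThree_iff]

/-- **One round of error reduction**: `bpErr P e ⊆ bpErr P (e² (3 - 2e))` for `e ≤ 1` — witness
`maj3Lang L' p`, coin polynomial `3p`. [Arora–Barak 2009, Thm. 7.10 (three independent runs)]
[cite: AroraBarakCC2009, Thm. 7.10] -/
theorem mem_bpErr_maj3 {L : Language Bool} {e : ℝ} (he : e ≤ 1) (hL : L ∈ bpErr Classes.P e) :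
    L ∈ bpErr Classes.P (e ^ 2 * (3 - 2 * e)) := by
  obtain ⟨L', hL', p, hp⟩ := hL
  refine ⟨maj3Lang L' p, maj3Lang_mem_P hL' p, 3 * p, fun x => ?_⟩
  have h3 : (3 * p : Polynomial ℕ).eval x.length =
      p.eval x.length + (p.eval x.length + p.eval x.length) := by
    simp; ring
  rw [h3, setOf_not_maj3Lang_iff]
  exact uniformProb_badTriples_le (hp x) he

/-! ### All rounds -/

/-- The error after `k` rounds: `e₀ = 1/3`, `eₖ₊₁ = eₖ² (3 - 2eₖ)`. [Arora–Barak 2009, Thm. 7.10]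
[folklore] -/
noncomputable def errSeq : ℕ → ℝ
  | 0 => 1 / 3
  | k + 1 => errSeq k ^ 2 * (3 - 2 * errSeq k)

/-- `errSeq (k+1) = (errSeq k)² (3 - 2 errSeq k)` (definitional). [folklore] -/
theorem errSeq_succ (k : ℕ) : errSeq (k + 1) = errSeq k ^ 2 * (3 - 2 * errSeq k) := rfl

/-- `0 ≤ errSeq k ≤ 1`. [folklore] -/
theorem errSeq_mem_Icc (k : ℕ) : 0 ≤ errSeq k ∧ errSeq k ≤ 1 := by
  induction k with
  | zero => norm_num [errSeq]
  | succ k ih =>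
    rw [errSeq_succ]
    refine ⟨mul_nonneg (sq_nonneg _) (by linarith [ih.2]), ?_⟩
    have h := sq_mul_three_sub_mono ih.1 ih.2 le_rfl
    linarith

/-- **`BPP ⊆ bpErr P (errSeq k)` for every `k`** (iterate `mem_bpErr_maj3` from
`bp_subset_bpErr_third`). [Arora–Barak 2009, Thm. 7.10] [cite: AroraBarakCC2009, Thm. 7.10] -/
theorem BPP_subset_bpErr_errSeq (k : ℕ) : BPP ⊆ bpErr Classes.P (errSeq k) := by
  induction k with
  | zero => exact bp_subset_bpErr_third Classes.P
  | succ k ih => exact fun L hL => mem_bpErr_maj3 (errSeq_mem_Icc k).2 (ih hL)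

/-- The errors `errSeq k` are eventually below every `ε > 0` (`err_bound_of_rec`:
`3 e₃₊ⱼ ≤ 2^{-2^j} ≤ 2^{-j}`). [Arora–Barak 2009, Thm. 7.10] [folklore] -/
theorem exists_errSeq_le {ε : ℝ} (hε : 0 < ε) : ∃ k, errSeq k ≤ ε := by
  obtain ⟨j, hj⟩ := exists_pow_lt_of_lt_one hε (show (1 / 2 : ℝ) < 1 by norm_num)
  refine ⟨3 + j, ?_⟩
  have h := err_bound_of_rec errSeq (by norm_num [errSeq]) (fun k => (errSeq_mem_Icc k).1)
    (fun k => (errSeq_succ k).le) j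
  have hpow : (1 / 2 : ℝ) ^ (2 ^ j) ≤ (1 / 2) ^ j :=
    pow_le_pow_of_le_one (by norm_num) (by norm_num) j.lt_two_pow_self.le
  linarith [(errSeq_mem_Icc (3 + j)).1]

/-- **`BPP` with any constant error**: `BPP ⊆ bpErr P ε` for every `ε > 0`.
[Arora–Barak 2009, §7.4.1 and Thm. 7.10; Sipser 2012, Lemma 10.5]
[cite: AroraBarakCC2009, Thm. 7.10] [cite: Sipser2012, Lemma 10.5] -/
theorem BPP_subset_bpErr {ε : ℝ} (hε : 0 < ε) : BPP ⊆ bpErr Classes.P ε := by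
  obtain ⟨k, hk⟩ := exists_errSeq_le hε
  rintro L hL
  obtain ⟨L', hL', p, hp⟩ := BPP_subset_bpErr_errSeq k hL
  exact ⟨L', hL', p, fun x => (hp x).trans hk⟩

/-! ### Machine form -/

namespace RandAlg

variable {α β : Type}

/-- **`RandAlg.pr` is a counting probability**: `A.pr ea x E = uniformProb (coinLen |ea x|)
{y | A.run x y ∈ E}`. [Arora–Barak 2009, §7.1; Mathlib `PMF.toOuterMeasure_map_apply`]
[folklore] -/
theorem pr_eq_uniformProb (A : RandAlg α β) (ea : α → List Bool) (x : α) (E : Set β) :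
    A.pr ea x E = uniformProb (A.coinLen (ea x).length) {y : List Bool | A.run x y ∈ E} := by
  rw [uniformProb_eq_toOuterMeasure, RandAlg.pr, RandAlg.outputPMF, PMF.toOuterMeasure_map_apply]
  rfl

end RandAlg

/-- The randomized algorithm of a witness language `L'` and a coin polynomial `p`: on input `x`
with coins `r`, output the verdict `[⟨x, r⟩ ∈ L']`; coin budget exactly `p(n)`.
[Gill 1977, Def. 5.2; Arora–Barak 2009, Def. 7.2 ↔ Def. 7.3] [cite: AroraBarakCC2009, Def. 7.3] -/
noncomputable def witnessAlg (L' : Language Bool) (p : Polynomial ℕ) : RandAlg (List Bool) Bool where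
  run x r := L'.boolIndicator (boolPair x r)
  coinLen n := p.eval n

/-- `witnessAlg L' p` is probabilistic polynomial time when `L' ∈ P`: its run map, read through
the pairing `boolPair`, *is* the indicator of `L'` (same machine, same polynomial), and the coin
budget is the polynomial `p`. [Gill 1977, Def. 5.2; Arora–Barak 2009, Def. 7.3]
[cite: AroraBarakCC2009, Def. 7.3] -/
theorem witnessAlg_isPolyTime {L' : Language Bool} (hL' : L' ∈ Classes.P) (p : Polynomial ℕ) :
    (witnessAlg L' p).IsPolyTime id encodeBool := by
  refine ⟨?_, p, fun n => le_rfl⟩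
  obtain ⟨P₀, M, hM⟩ := polyTimeDecidable_iff.1 (mem_P_iff_holds.1 hL')
  exact ⟨P₀, M, fun q => hM (boolPair q.1 q.2)⟩

/-- The error of `witnessAlg L' p` on `x` is the counting probability of the wrong-verdict
event of `L'` at `x`. [Arora–Barak 2009, Def. 7.2 ↔ Def. 7.3] [folklore] -/
theorem witnessAlg_pr_ne (L L' : Language Bool) (p : Polynomial ℕ) (x : List Bool) :
    (witnessAlg L' p).pr id x {b | b ≠ L.boolIndicator x} =
      uniformProb (p.eval x.length) {y : List Bool | ¬ (boolPair x y ∈ L' ↔ x ∈ L)} := by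
  rw [RandAlg.pr_eq_uniformProb]
  congr 1
  ext y
  exact boolIndicator_ne_boolIndicator_iff (boolPair x y) x

/-- **Discharge of `exists_randAlg_error_le_of_mem_BPP`** (error reduction for `BPP` to any
constant `ε > 0`, machine form): by `BPP_subset_bpErr`, `L ∈ BPP` has a witness `L' ∈ P` with
coin polynomial `p` and wrong-verdict probability `≤ ε` on every input; the algorithm
`witnessAlg L' p` is probabilistic polynomial time with coin budget exactly `p` and
`Pr[A(x) = [x ∈ L]] = 1 - Pr[A(x) ≠ [x ∈ L]] ≥ 1 - ε` (`pr_ne_eq_one_sub`).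
[Arora–Barak 2009, §7.4.1 and Thm. 7.10; Sipser 2012, Lemma 10.5; Gill 1977, Def. 5.2]
[cite: AroraBarakCC2009, Thm. 7.10] [cite: Sipser2012, Lemma 10.5] -/
theorem exists_randAlg_error_le_of_mem_BPP_holds : exists_randAlg_error_le_of_mem_BPP := by
  intro L hL ε hε
  obtain ⟨L', hL', p, hp⟩ := BPP_subset_bpErr hε hL
  refine ⟨witnessAlg L' p, witnessAlg_isPolyTime hL' p, ⟨p, fun n => rfl⟩, fun x => ?_⟩
  have h₁ := RandAlg.pr_ne_eq_one_sub (witnessAlg L' p) id x (L.boolIndicator x)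
  have h₂ := witnessAlg_pr_ne L L' p x
  have h₃ := hp x
  linarith

end Literature.Computability.Complexity
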